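import Summits.AtomisticToContinuum.Crystallization.Theorems.PerronTransitivityTransitiveLocalLimitSuperBoundSparseOfK
import Summits.AtomisticToContinuum.Crystallization.Theorems.PerronTransitivityTransitiveLocalLimitStubConcentration
import Summits.AtomisticToContinuum.Crystallization.Theorems.PerronTransitivityTransitiveLocalLimitStubCentredLocalLimit
import Summits.AtomisticToContinuum.Crystallization.Theorems.PerronTransitivityTransitiveLocalLimitStubSiteEnergyContinuity

/-!
# Route `PerronTransitivity`, support item `FractionalGainGivesTransitivity` (stmt-AtomisticToContinuum-15101):
# K* ⇒ `TransitiveLocalLimit`, through the registered line of the crux (stmt-AtomisticToContinuum-15100)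

`fractionalGainGivesTransitivity_proof : PerronTransitivity.FractionalGainGivesTransitivity`, i.e.
`NoFractionalGain → TransitiveLocalLimit`.  The file carries

* `TransitiveLocalLimit_of_parts` — the KERNEL-CHECKED COMPOSITION of the registered line `Lines/birth.lean`
  (sha a672f687…) of the crux `TransitiveLocalLimit`, copied verbatim into the `Theorems` tree:
  `stub₁-sig → stub₂-sig → stub₃-sig → stub₄-sig → <crux statement verbatim>` (stub₁ = `stub_superBoundSparse`,
  no density of `θ`-super-bound sites in Lennard-Jones ground states — OPEN, the heart; stub₂ =
  `stub_concentration_of_superBoundSparse`, stub₃ = `stub_centredLocalLimit`, stub₄ = `stub_siteEnergyContinuity`,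
  all three LANDED in this namespace), with its glue lemma `siteEnergy_add_const`;
* `transitiveLocalLimit_of_noFractionalGain` — the composition applied to the K*-conditional stub 1
  `superBoundSparse_of_noFractionalGain hK` (weights `c = 1 + t·1_S` in K*, LANDED) and stubs 2–4;
* `fractionalGainGivesTransitivity_proof` — the support item itself.

Consequently the crux `TransitiveLocalLimit` (stmt-15100) is reduced, inside the tree, to the crux
`NoFractionalGain` (stmt-15098); when `stub_superBoundSparse` is proved unconditionally, `TransitiveLocalLimit_of_parts`
applied to the four stubs is the crux BY NAME.

PROOF of the composition (real, [folklore]): separation of ground states from the PROVED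
`LennardJonesMinimalDistance_holds`; stubs 1+2 give two-sided concentration of site energies at `2E*`; stub 3
extracts the centred limit `(X, σ, τ)` with eventual `θ`-goodness; at `p ∈ X`, for every `γ > 0` some late `j`
has a particle within `min ε 1` of `p` whose site energy is within `γ/2` of BOTH `U_X(p)` (stub 4, translation
invariance `siteEnergy_add_const`) and `2E*` (goodness at radius `‖p‖ + 1`), so `|U_X(p) − 2E*| ≤ γ`;
`eq_of_forall_dist_le`.
-/

noncomputable section

namespace Summit.AtomisticToContinuum.Crystallization.Theorems.TransitiveLocalLimitBirth


open Filter

/-! ## Glue lemma (proved) -/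

/-- Translating a finite configuration does not change its site energies. [folklore] -/
theorem siteEnergy_add_const {N : ℕ} (V : ℝ → ℝ) (y : Fin N → EuclideanSpace ℝ (Fin 3)) (c : EuclideanSpace ℝ (Fin 3)) (i : Fin N) :
    Literature.MathematicalPhysics.StatisticalMechanics.siteEnergy V (fun k => y k + c) i = Literature.MathematicalPhysics.StatisticalMechanics.siteEnergy V y i := by
  unfold Literature.MathematicalPhysics.StatisticalMechanics.siteEnergy
  refine Finset.sum_congr rfl fun k _ => ?_
  rw [dist_add_right]

/-! ## The kernel-checked composition (no `sorry` of its own) -/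

/-- THE REAL PROOF (sorry-free, axioms `propext`/`Classical.choice`/`Quot.sound`):
`stub_superBoundSparse-sig → stub_concentration_of_superBoundSparse-sig → stub_centredLocalLimit-sig →
stub_siteEnergyContinuity-sig → <the crux statement>`; the conclusion is the text of the route decl
`PerronTransitivity.TransitiveLocalLimit` VERBATIM (definitionally equal; it is spelled out, not named, so that
the eventual crux file's `TransitiveLocalLimit_of` — this composition applied to the four stubs — is the only
theorem concluding the crux BY NAME, as the `#h21_check_skeleton` audit requires). [folklore] -/
theorem TransitiveLocalLimit_of_parts : (∀ x : (N : ℕ) → (Fin N → EuclideanSpace ℝ (Fin 3)), (∀ N, Literature.MathematicalPhysics.StatisticalMechanics.IsGroundState Literature.MathematicalPhysics.StatisticalMechanics.lennardJones (x N)) → ∀ θ : ℝ, 0 < θ → Filter.Tendsto (fun N : ℕ => ((Finset.univ.filter fun i : Fin N => Literature.MathematicalPhysics.StatisticalMechanics.siteEnergy Literature.MathematicalPhysics.StatisticalMechanics.lennardJones (x N) i ≤ 2 * (⨅ Q : Literature.MathematicalPhysics.StatisticalMechanics.PeriodicConfiguration 3, Q.energyPerParticle Literature.MathematicalPhysics.StatisticalMechanics.lennardJones)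 - θ).card : ℝ) / N) Filter.atTop (nhds 0)) → (∀ x : (N : ℕ) → (Fin N → EuclideanSpace ℝ (Fin 3)), (∀ N, Literature.MathematicalPhysics.StatisticalMechanics.IsGroundState Literature.MathematicalPhysics.StatisticalMechanics.lennardJones (x N)) → (∀ θ : ℝ, 0 < θ → Filter.Tendsto (fun N : ℕ => ((Finset.univ.filter fun i : Fin N => Literature.MathematicalPhysics.StatisticalMechanics.siteEnergy Literature.MathematicalPhysics.StatisticalMechanics.lennardJones (x N) i ≤ 2 * (⨅ Q : Literature.MathematicalPhysics.StatisticalMechanics.PeriodicConfiguration 3, Q.energyPerParticle Literature.MathematicalPhysics.StatisticalMechanics.lennardJones) - θ).card : ℝ) / N) Filter.atTop (nhds 0)) → ∀ θ : ℝ, 0 < θ → Filter.Tendsto (fun N : ℕ => ((Finset.univ.filter fun i : Fin N => θ < |Literature.MathematicalPhysics.StatisticalMechanics.siteEnergy Literature.MathematicalPhysics.StatisticalMechanics.lennardJones (x N) i - 2 * (⨅ Q : Literature.MathematicalPhysics.StatisticalMechanics.PeriodicConfiguration 3, Q.energyPerParticle Literature.MathematicalPhysics.StatisticalMechanics.lennardJones)|).card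 : ℝ) / N) Filter.atTop (nhds 0)) → (∀ x : (N : ℕ) → (Fin N → EuclideanSpace ℝ (Fin 3)), (∃ δ : ℝ, 0 < δ ∧ ∀ (N : ℕ) (i j : Fin N), i ≠ j → δ ≤ dist (x N i) (x N j)) → ∀ L : ℝ, (∀ θ : ℝ, 0 < θ → Filter.Tendsto (fun N : ℕ => ((Finset.univ.filter fun i : Fin N => θ < |Literature.MathematicalPhysics.StatisticalMechanics.siteEnergy Literature.MathematicalPhysics.StatisticalMechanics.lennardJones (x N) i - L|).card : ℝ) / N) Filter.atTop (nhds 0)) → ∃ (X : Set (EuclideanSpace ℝ (Fin 3))) (σ : ℕ → ℕ) (τ : ℕ → EuclideanSpace ℝ (Fin 3)), X.Nonempty ∧ (∃ δ : ℝ, 0 < δ ∧ ∀ p ∈ X, ∀ q ∈ X, p ≠ q → δ ≤ dist p q) ∧ StrictMono σ ∧ (∀ R ε : ℝ, 0 < ε → ∀ᶠ j : ℕ in Filter.atTop, (∀ p ∈ X, ‖p‖ ≤ R → ∃ i : Fin (σ j), dist (x (σ j) i + τ j) p ≤ ε) ∧ (∀ i : Fin (σ j), ‖x (σ j) i + τ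 j‖ ≤ R → ∃ p ∈ X, dist (x (σ j) i + τ j) p ≤ ε)) ∧ (∀ R θ : ℝ, 0 < θ → ∀ᶠ j : ℕ in Filter.atTop, ∀ i : Fin (σ j), ‖x (σ j) i + τ j‖ ≤ R → |Literature.MathematicalPhysics.StatisticalMechanics.siteEnergy Literature.MathematicalPhysics.StatisticalMechanics.lennardJones (x (σ j)) i - L| ≤ θ)) → (∀ (n : ℕ → ℕ) (z : (j : ℕ) → (Fin (n j) → EuclideanSpace ℝ (Fin 3))) (X : Set (EuclideanSpace ℝ (Fin 3))) (δ : ℝ), 0 < δ → (∀ (j : ℕ) (i i' : Fin (n j)), i ≠ i' → δ ≤ dist (z j i) (z j i')) → (∃ δ : ℝ, 0 < δ ∧ ∀ p ∈ X, ∀ q ∈ X, p ≠ q → δ ≤ dist p q) → (∀ R ε : ℝ, 0 < ε → ∀ᶠ j : ℕ in Filter.atTop, (∀ p ∈ X, ‖p‖ ≤ R → ∃ i : Fin (n j), dist (z j i) p ≤ ε) ∧ (∀ i : Fin (n j), ‖z j i‖ ≤ R → ∃ p ∈ X, dist (z j i) p ≤ ε)) → ∀ p ∈ X, ∀ γ :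 ℝ, 0 < γ → ∃ ε : ℝ, 0 < ε ∧ ∀ᶠ j : ℕ in Filter.atTop, ∀ i : Fin (n j), dist (z j i) p ≤ ε → |Literature.MathematicalPhysics.StatisticalMechanics.siteEnergy Literature.MathematicalPhysics.StatisticalMechanics.lennardJones (z j) i - ∑' q : {q : EuclideanSpace ℝ (Fin 3) // q ∈ X ∧ q ≠ p}, Literature.MathematicalPhysics.StatisticalMechanics.lennardJones (dist p q.1)| ≤ γ) → (∀ x : (N : ℕ) → (Fin N → EuclideanSpace ℝ (Fin 3)), (∀ N, Literature.MathematicalPhysics.StatisticalMechanics.IsGroundState Literature.MathematicalPhysics.StatisticalMechanics.lennardJones (x N)) → ∃ (X : Set (EuclideanSpace ℝ (Fin 3))) (σ : ℕ → ℕ) (τ : ℕ → EuclideanSpace ℝ (Fin 3)), X.Nonempty ∧ (∃ δ : ℝ, 0 < δ ∧ ∀ p ∈ X, ∀ q ∈ X, p ≠ q → δ ≤ dist p q) ∧ StrictMono σ ∧ (∀ R ε : ℝ, 0 < ε → ∀ᶠ j : ℕ in Filter.atTop, (∀ p ∈ X, ‖p‖ ≤ R → ∃ i : Fin (σ j), dist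 (x (σ j) i + τ j) p ≤ ε) ∧ (∀ i : Fin (σ j), ‖x (σ j) i + τ j‖ ≤ R → ∃ p ∈ X, dist (x (σ j) i + τ j) p ≤ ε)) ∧ ∀ p ∈ X, ∑' q : {q : EuclideanSpace ℝ (Fin 3) // q ∈ X ∧ q ≠ p}, Literature.MathematicalPhysics.StatisticalMechanics.lennardJones (dist p q.1) = 2 * ⨅ Q : Literature.MathematicalPhysics.StatisticalMechanics.PeriodicConfiguration 3, Q.energyPerParticle Literature.MathematicalPhysics.StatisticalMechanics.lennardJones) := by
  intro h1 h2 h3 h4 x hx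
  -- (1)+(2): two-sided concentration of the finite-`N` site energies at the level `2E*`
  have hconc := h2 x hx (h1 x hx)
  -- uniform minimal distance of Lennard-Jones ground states (PROVED in tree)
  obtain ⟨δ, hδ, hδsep⟩ := Literature.MathematicalPhysics.StatisticalMechanics.LennardJonesMinimalDistance_holds
  have hxsep : ∃ δ : ℝ, 0 < δ ∧ ∀ (N : ℕ) (i j : Fin N), i ≠ j → δ ≤ dist (x N i) (x N j) :=
    ⟨δ, hδ, fun N i j hij => hδsep N (x N) (hx N) i j hij⟩
  -- (3): centred extraction of a non-empty uniformly discrete local limit around good particles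
  obtain ⟨X, σ, τ, hne, hXsep, hσ, hmatch, hgood⟩ := h3 x hxsep _ hconc
  refine ⟨X, σ, τ, hne, hXsep, hσ, hmatch, fun p hp => ?_⟩
  -- (4): continuity of site energies along the translated subsequence, at the limit point `p`
  have hzsep : ∀ (j : ℕ) (i i' : Fin (σ j)), i ≠ i' →
      δ ≤ dist (x (σ j) i + τ j) (x (σ j) i' + τ j) := by
    intro j i i' hii'
    rw [dist_add_right]
    exact hδsep (σ j) (x (σ j)) (hx (σ j)) i i' hii'
  have hcont := h4 σ (fun j i => x (σ j) i + τ j) X δ hδ hzsep hXsep hmatch p hp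
  -- the site energy of `X` at `p` is within every `γ > 0` of `2E*`
  refine eq_of_forall_dist_le fun γ hγ => ?_
  obtain ⟨ε, hε, hεj⟩ := hcont (γ / 2) (half_pos hγ)
  have e2 := hmatch ‖p‖ (min ε 1) (lt_min hε one_pos)
  have e3 := hgood (‖p‖ + 1) (γ / 2) (half_pos hγ)
  obtain ⟨j, hj1, ⟨hj2, -⟩, hj3⟩ := (hεj.and (e2.and e3)).exists
  obtain ⟨i, hi⟩ := hj2 p hp le_rfl
  have hiε : dist (x (σ j) i + τ j) p ≤ ε := hi.trans (min_le_left _ _)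
  have hi1 : dist (x (σ j) i + τ j) p ≤ 1 := hi.trans (min_le_right _ _)
  have hnorm : ‖x (σ j) i + τ j‖ ≤ ‖p‖ + 1 := by
    have h := norm_le_norm_add_norm_sub' (x (σ j) i + τ j) p
    rw [← dist_eq_norm] at h
    linarith
  -- particle `i` is late and close to `p`: its site energy is `γ/2`-close to both `U_X(p)` and `2E*`
  have hA : |Literature.MathematicalPhysics.StatisticalMechanics.siteEnergy Literature.MathematicalPhysics.StatisticalMechanics.lennardJones (x (σ j)) i -
      ∑' q : {q : EuclideanSpace ℝ (Fin 3) // q ∈ X ∧ q ≠ p}, Literature.MathematicalPhysics.StatisticalMechanics.lennardJones (dist p q.1)| ≤ γ / 2 := by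
    simpa only [siteEnergy_add_const] using hj1 i hiε
  have hB := hj3 i hnorm
  rw [abs_sub_comm] at hA
  rw [Real.dist_eq]
  exact (abs_sub_le _ _ _).trans ((add_le_add hA hB).trans_eq (add_halves γ))


/-! ## K* ⇒ the crux; the support item -/

/-- K* ⇒ the exactly energy-transitive local limit: under `NoFractionalGain`, every sequence of
Lennard-Jones ground states has, along a subsequence and after translations, a non-empty uniformly
discrete local limit every site of which has site energy exactly `2E*` (the composition applied to the
K*-conditional stub 1 and the landed stubs 2–4). [folklore] -/
theorem transitiveLocalLimit_of_noFractionalGain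
    (hK : Summit.AtomisticToContinuum.Crystallization.Theses.PerronTransitivity.NoFractionalGain) :
    Summit.AtomisticToContinuum.Crystallization.Theses.PerronTransitivity.TransitiveLocalLimit :=
  TransitiveLocalLimit_of_parts (superBoundSparse_of_noFractionalGain hK)
    stub_concentration_of_superBoundSparse stub_centredLocalLimit stub_siteEnergyContinuity

/-- **Support item `FractionalGainGivesTransitivity`** (stmt-AtomisticToContinuum-15101) of route
`PerronTransitivity`: `NoFractionalGain → TransitiveLocalLimit`. [folklore] -/
theorem fractionalGainGivesTransitivity_proof :
    Summit.AtomisticToContinuum.Crystallization.Theses.PerronTransitivity.FractionalGainGivesTransitivity :=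
  fun hK => transitiveLocalLimit_of_noFractionalGain hK

end Summit.AtomisticToContinuum.Crystallization.Theorems.TransitiveLocalLimitBirth

end
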